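import Literature.AnabelianGeometry.EtaleTheta.TemperedFrobenioidOfBaseFieldHull
import Literature.AnabelianGeometry.EtaleTheta.TemperedFrobenioidOfRankOneBaseRatFn
import Literature.AnabelianGeometry.EtaleTheta.Discharge.Sec5BaseFieldHullDictionaryFacts
import HarnessLib

/-!
# [EtTh] Def. 3.6 (iii)/(iv), Lemma 5.8: the birational units of the base-field-theoretic hull READ IN `ℚ̄_p` — `O^×(A^birat) ≅ K_U^×`,
# the natural action is the Galois action, and the constants `K^× ↪ O^×(A^birat)` are `Aut`-fixed (`hconst`) (class (b) construction)

S. Mochizuki, *The étale theta function …*, Publ. RIMS **45** (2009) [MochizukiEtTh2009]: Def. 3.3 (iii) p.299 (PDF p.73) and Prop. 3.4 (ii)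
p.300 (PDF p.74) (`F₀`, «`L^× ≅ F₀(Y^log)`»), Def. 3.6 (iv) p.304 (PDF p.78) (the base-field-theoretic hull), Def. 4.1 (iii) p.313 (PDF p.87)
(the natural action of `Aut_C(A)` on `O^×(A^birat)`), Lemma 5.8 p.331 (PDF p.105) («the natural inclusion `K^× ↪ O^×(B_N^birat)`»; «`Π^tp_Y`
[i.e., `G_K` …] acts»).  [cite: MochizukiEtTh2009, Lem 5.8 p.331 (PDF p.105); Def 4.1 (iii) p.313 (PDF p.87)]

abc-iut cell, layer L2, seat abc-iut-L2-d3 (gen 10); L2-lead ruling R1112 «CONST-DICT CARRIER = C^{bs-fld} HULL OVER THE GENUINE BASE», junction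
step (b).  CLASS (b) CONSTRUCTION over this lineage's hull (`TemperedFrobenioidOfBaseFieldHull.lean`, p500929) and the GENERIC engine
dictionary `RankOneBase.biratUnitsEquiv : B₀(F A_D) ≃* O^×(A^birat)` (`TemperedFrobenioidOfRankOneBaseRatFn.lean`), for ANY tempered `Γ`,
ANY `a : Γ → G_{ℚ_p}` with open images:
* **`reading A : O^×(A^birat) →* ℚ̄_p^×`** for every object `A` of the hull (over `Γ/U`, `U := (F A_D)`): the birational unit, as a
  `Γ`-equivariant function `Γ/U → ℚ̄_p^×`, EVALUATED AT THE BASE POINT — injective (`reading_injective`) with image EXACTLY the nonzero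
  elements of `K_U = ℚ̄_p^{a(U)}` (`range_reading`; so `O^×(A^birat) ≅ K_U^×`, Prop. 3.4 (ii));
* **`reading_biratAutModel`** — «the natural action» of `σ ∈ Aut_C(A)` on `O^×(A^birat)` (abc-iut-L2-t9's `biratAutModel`) READS AS THE
  GALOIS ACTION: `reading (σ · u) = a(g) · reading u` for any `g ∈ Γ` representing the base automorphism `Base(σ⁻¹)` at the base point
  (Lemma 5.8: «`Π^tp_Y` [i.e., `G_K`, via `Π^tp_Y ↠ G_K`] acts»);
* **`constEmb K hK A : K^× →* O^×(A^birat)`** («the natural inclusion `K^× ↪ O^×(A^birat)`», for any finite `K ⊆ ℚ̄_p` with `a(Γ) ≤ G_K`):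
  the constant functions `g·U ↦ a(g)·k = k`; `reading ∘ constEmb = inclusion` (`reading_constEmb`), injective; and **`hconst`**:
  `biratAutModel A σ (constEmb k) = constEmb k` for EVERY `σ ∈ Aut_C(A)` (`biratAutModel_constEmb`) — the binder `hconst` of abc-iut-L2-t4's
  §5 data is a THEOREM at the hull for this shape of `constEmb` (independently of abc-iut-w4-d008's terminal-object route);
* (remark) the hull is NOT carrier-blocked by abc-iut-L2-t11's no-go (p497045 concerns carriers with COUNTABLY many birational units):
  `O^×(A^birat) ≅ K_U^× ⊇ ℚ_p^×` is uncountable.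
HONEST LABEL: genuine constants / Galois action at a carrier with DEGENERATE divisor geometry; these are the `Cst`/`ν̃`/`constEmb`/`hconst`
ingredients of the constants dictionary at the hull — the `N`-th-root objects `B_N` (junction step (c)) are NOT constructed here.  No
instance, no notation, no `Prop`-valued definition, no sorry; nothing here bears on [IUTchIII] Cor. 3.12; no side taken; typed ≠ proved.
-/

noncomputable section

namespace Literature.AnabelianGeometry.EtaleTheta

open CategoryTheory Opposite Function Literature.AlgebraicGeometry.Frobenioids Literature.AnabelianGeometry.SemiGraphs

namespace BsFldHull

variable (p : ℕ) [Fact p.Prime] {Γ : Type} [Group Γ] [TopologicalSpace Γ] (a : Γ →* GQp p)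
  (ha : ∀ U : OpenSubgroup Γ, IsOpen ((U.toSubgroup.map a : Subgroup (GQp p)) : Set (GQp p)))

/-! ## The constants `K^×` as functions of every covering -/

variable (K : IntermediateField ℚ_[p] (PadicAlgCl p)) (hK : ∀ g : Γ, a g ∈ K.fixingSubgroup)

/-- `K^×` as units of `ℚ̄_p` lying in `K`. [cite: MochizukiEtTh2009, Def 3.6 (iv) p.304 (PDF p.78)] -/
def unitsOfK : (K)ˣ →* (PadicAlgCl p)ˣ := Units.map (algebraMap K (PadicAlgCl p) : K →* PadicAlgCl p)

/-- The underlying element of `unitsOfK k` is `k`. [cite: MochizukiEtTh2009, Def 3.6 (iv) p.304 (PDF p.78)] -/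
@[simp] theorem coe_unitsOfK (k : (K)ˣ) : ((unitsOfK p K k : (PadicAlgCl p)ˣ) : PadicAlgCl p) = ((k : K) : PadicAlgCl p) := rfl

/-- `unitsOfK` is injective. [cite: MochizukiEtTh2009, Def 3.6 (iv) p.304 (PDF p.78)] -/
theorem unitsOfK_injective : Injective (unitsOfK p K) := by
  intro k k' h
  have := congrArg (fun u : (PadicAlgCl p)ˣ => (u : PadicAlgCl p)) h
  simp only [coe_unitsOfK] at this
  exact Units.ext (Subtype.ext this)

/-- **The constant function `g·U ↦ k` of `Γ/U` with value `k ∈ K^×`** (`K ⊆ K_U`; `a(Γ)` fixes `K`), as a homomorphism `K^× → B₀(Γ/U)`.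
[cite: MochizukiEtTh2009, Def 3.3 (iii) p.299 (PDF p.73)] -/
def constFun (U : CosetCat Γ) : (K)ˣ →* eqvFun p a U where
  toFun k := ofFixed p a U (unitsOfK p K k) (le_fixFld_of_forall_mem p a K hK U.sg (k : K).2)
  map_one' := ev_injective p a U (by rw [ev_ofFixed, map_one, map_one])
  map_mul' k k' := ev_injective p a U (by rw [ev_ofFixed, map_mul, map_mul, ev_ofFixed, ev_ofFixed])

/-- `ev (constFun k) = k`. [cite: MochizukiEtTh2009, Def 3.3 (iii) p.299 (PDF p.73)] -/
@[simp] theorem ev_constFun (U : CosetCat Γ) (k : (K)ˣ) : ev p a U (constFun p a K hK U k) = unitsOfK p K k :=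
  ev_ofFixed p a U (unitsOfK p K k) (le_fixFld_of_forall_mem p a K hK U.sg (k : K).2)


/-! ## The reading of the birational units of the hull -/

variable [IsTopologicalGroup Γ] (hΓ : IsTempered Γ) (R S : ((ConnectedPart (BTemp Γ))ᵒᵖ ⥤ CommMonCat.{0}) → Prop)

/-- The open subgroup `U ⊆ Γ` under an object `A` of the hull (`A` lies over `Γ/U`). [cite: MochizukiEtTh2009, Def 3.6 p.303 (PDF p.77)] -/
abbrev sgOf (A : (temperedFrobenioid p a ha hΓ R S).category) : CosetCat Γ := (equiv hΓ).inverse.obj A.base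

/-- **`O^×(A^birat) ≅ B₀(Γ/U) = Hom_Γ(Γ/U, ℚ̄_p^×)`** at the hull (the generic engine dictionary `RankOneBase.biratUnitsEquiv`).
[cite: MochizukiEtTh2009, Def 4.1 p.312 (PDF p.86)] -/
abbrev unitsEquiv (A : (temperedFrobenioid p a ha hΓ R S).category) :
    eqvFun p a (sgOf p a ha hΓ R S A) ≃* (temperedFrobenioid p a ha hΓ R S).biratUnitsModel A :=
  TemperedFrobenioid.RankOneBase.biratUnitsEquiv (hpf p a ha) (rankOneBase p a ha hΓ) _ _ _ R S A

/-- **The reading `O^×(A^birat) → ℚ̄_p^×`**: the birational unit as an equivariant function, evaluated at the base point `1·U`.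
[cite: MochizukiEtTh2009, Lem 5.8 p.331 (PDF p.105)] -/
def reading (A : (temperedFrobenioid p a ha hΓ R S).category) : (temperedFrobenioid p a ha hΓ R S).biratUnitsModel A →* (PadicAlgCl p)ˣ :=
  (ev p a (sgOf p a ha hΓ R S A)).comp (unitsEquiv p a ha hΓ R S A).symm.toMonoidHom

/-- `reading u = ev ((unitsEquiv A)⁻¹ u)`. [cite: MochizukiEtTh2009, Lem 5.8 p.331 (PDF p.105)] -/
theorem reading_apply (A : (temperedFrobenioid p a ha hΓ R S).category) (u : (temperedFrobenioid p a ha hΓ R S).biratUnitsModel A) :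
    reading p a ha hΓ R S A u = ev p a _ ((unitsEquiv p a ha hΓ R S A).symm u) := rfl

/-- `reading (unitsEquiv b) = ev b`. [cite: MochizukiEtTh2009, Lem 5.8 p.331 (PDF p.105)] -/
@[simp] theorem reading_unitsEquiv (A : (temperedFrobenioid p a ha hΓ R S).category) (b : eqvFun p a (sgOf p a ha hΓ R S A)) :
    reading p a ha hΓ R S A (unitsEquiv p a ha hΓ R S A b) = ev p a _ b := by
  rw [reading_apply, MulEquiv.symm_apply_apply]

/-- **The reading is injective** (`O^×(A^birat) ↪ ℚ̄_p^×`). [cite: MochizukiEtTh2009, Lem 5.8 p.331 (PDF p.105)] -/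
theorem reading_injective (A : (temperedFrobenioid p a ha hΓ R S).category) : Injective (reading p a ha hΓ R S A) :=
  (ev_injective p a _).comp (unitsEquiv p a ha hΓ R S A).symm.injective

/-- **`O^×(A^birat) ≅ K_U^×` on the nose**: the image of the reading is EXACTLY the set of nonzero elements of `K_U = ℚ̄_p^{a(U)}`.
[cite: MochizukiEtTh2009, Prop 3.4 (ii) p.300 (PDF p.74)] -/
theorem range_reading (A : (temperedFrobenioid p a ha hΓ R S).category) :
    Set.range (fun u => ((reading p a ha hΓ R S A u : (PadicAlgCl p)ˣ) : PadicAlgCl p)) =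
      {x : PadicAlgCl p | x ∈ fixFld p a (sgOf p a ha hΓ R S A).sg ∧ x ≠ 0} := by
  rw [← range_ev p a (sgOf p a ha hΓ R S A)]
  ext x
  constructor
  · rintro ⟨u, rfl⟩
    exact ⟨(unitsEquiv p a ha hΓ R S A).symm u, rfl⟩
  · rintro ⟨b, rfl⟩
    exact ⟨unitsEquiv p a ha hΓ R S A b, by simp only [reading_unitsEquiv]⟩

/-- The values of the reading lie in `K_U`. [cite: MochizukiEtTh2009, Prop 3.4 (ii) p.300 (PDF p.74)] -/
theorem reading_mem_fixFld (A : (temperedFrobenioid p a ha hΓ R S).category) (u : (temperedFrobenioid p a ha hΓ R S).biratUnitsModel A) :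
    ((reading p a ha hΓ R S A u : (PadicAlgCl p)ˣ) : PadicAlgCl p) ∈ fixFld p a (sgOf p a ha hΓ R S A).sg :=
  ev_mem_fixFld p a _ _

/-- **The natural action READS AS THE GALOIS ACTION**: for `σ ∈ Aut_C(A)` and any `g ∈ Γ` with `Base(σ⁻¹)(1·U) = g·U`,
`reading (σ · u) = a(g) · reading u` (abc-iut-L2-t9's `biratAutModel` = pull-back along `Base(σ⁻¹)`; the generic
`biratUnitsEquiv_symm_biratAutModel`; this lineage's `ev_pullFun`).  [cite: MochizukiEtTh2009, Def 4.1 (iii) p.313 (PDF p.87); Lem 5.8 p.331 (PDF p.105)] -/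
theorem reading_biratAutModel (A : (temperedFrobenioid p a ha hΓ R S).category) (σ : Aut A)
    (u : (temperedFrobenioid p a ha hΓ R S).biratUnitsModel A) {g : Γ}
    (hg : CosetCat.pt ((equiv hΓ).inverse.map (ModelFrobenioid.baseMap σ.inv)) = (g : (sgOf p a ha hΓ R S A).carrier)) :
    reading p a ha hΓ R S A ((temperedFrobenioid p a ha hΓ R S).biratAutModel A σ u) = a g • reading p a ha hΓ R S A u := by
  rw [reading_apply, reading_apply]
  have h := TemperedFrobenioid.RankOneBase.biratUnitsEquiv_symm_biratAutModel (hpf p a ha) (rankOneBase p a ha hΓ)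
    QuasiTemperoid.BTempConnected.connectedPart_isConnected QuasiTemperoid.BTempConnected.connectedPart_isTotallyEpimorphic
    QuasiTemperoid.BTempConnected.connectedPart_isOfFSMType R S A σ u
  exact (congrArg (ev p a _) h).trans
    (ev_pullFun p a ((equiv hΓ).inverse.map (ModelFrobenioid.baseMap σ.inv)) ((unitsEquiv p a ha hΓ R S A).symm u) hg)

/-- **Pull-back of birational units along a morphism `φ : A' → A` of the hull READS AS A GALOIS TRANSLATE**: `reading (φ^* u) = a(g) · reading u`
for any `g` representing `Base(φ)` at the base point (abc-iut-L2-t9's `pullFracModel = B(Base φ)`; `ev_pullFun`).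
[cite: MochizukiEtTh2009, Prop 4.2 (iii) p.314 (PDF p.88)] -/
theorem reading_pullFracModel {A A' : (temperedFrobenioid p a ha hΓ R S).category} (φ : A' ⟶ A)
    (u : (temperedFrobenioid p a ha hΓ R S).biratUnitsModel A) {g : Γ}
    (hg : CosetCat.pt ((equiv hΓ).inverse.map (ModelFrobenioid.baseMap φ)) = (g : (sgOf p a ha hΓ R S A).carrier)) :
    reading p a ha hΓ R S A' ((temperedFrobenioid p a ha hΓ R S).pullFracModel φ u) = a g • reading p a ha hΓ R S A u := by
  rw [reading_apply, reading_apply]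
  have h1 := TemperedFrobenioid.RankOneBase.biratUnitsEquiv_symm_apply (hpf p a ha) (rankOneBase p a ha hΓ)
    QuasiTemperoid.BTempConnected.connectedPart_isConnected QuasiTemperoid.BTempConnected.connectedPart_isTotallyEpimorphic
    QuasiTemperoid.BTempConnected.connectedPart_isOfFSMType R S A' ((temperedFrobenioid p a ha hΓ R S).pullFracModel φ u)
  have h2 := TemperedFrobenioid.RankOneBase.biratUnitsEquiv_symm_apply (hpf p a ha) (rankOneBase p a ha hΓ)
    QuasiTemperoid.BTempConnected.connectedPart_isConnected QuasiTemperoid.BTempConnected.connectedPart_isTotallyEpimorphic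
    QuasiTemperoid.BTempConnected.connectedPart_isOfFSMType R S A u
  have h3 : (unitsEquiv p a ha hΓ R S A').symm ((temperedFrobenioid p a ha hΓ R S).pullFracModel φ u) =
      pullFun p a ((equiv hΓ).inverse.map (ModelFrobenioid.baseMap φ)) ((unitsEquiv p a ha hΓ R S A).symm u) := by
    refine h1.trans ?_
    rw [show (unitsEquiv p a ha hΓ R S A).symm u = _ from h2]
    rfl
  rw [h3]
  exact ev_pullFun p a _ _ hg

/-! ## The constants `K^× ↪ O^×(A^birat)` and `hconst` -/

/-- **«The natural inclusion `K^× ↪ O^×(A^birat)`»** at the hull: `constEmb := unitsEquiv ∘ constFun`.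
[cite: MochizukiEtTh2009, Lem 5.8 p.331 (PDF p.105)] -/
def constEmb (A : (temperedFrobenioid p a ha hΓ R S).category) : (K)ˣ →* (temperedFrobenioid p a ha hΓ R S).biratUnitsModel A :=
  (unitsEquiv p a ha hΓ R S A).toMonoidHom.comp (constFun p a K hK (sgOf p a ha hΓ R S A))

/-- **The constants READ onto themselves**: `reading (constEmb k) = k`. [cite: MochizukiEtTh2009, Lem 5.8 p.331 (PDF p.105)] -/
@[simp] theorem reading_constEmb (A : (temperedFrobenioid p a ha hΓ R S).category) (k : (K)ˣ) :
    reading p a ha hΓ R S A (constEmb p a ha K hK hΓ R S A k) = unitsOfK p K k := by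
  change reading p a ha hΓ R S A (unitsEquiv p a ha hΓ R S A (constFun p a K hK _ k)) = _
  rw [reading_unitsEquiv, ev_constFun]

/-- `constEmb` is injective. [cite: MochizukiEtTh2009, Lem 5.8 p.331 (PDF p.105)] -/
theorem constEmb_injective (A : (temperedFrobenioid p a ha hΓ R S).category) : Injective (constEmb p a ha K hK hΓ R S A) := by
  intro k k' h
  have h' := congrArg (reading p a ha hΓ R S A) h
  rw [reading_constEmb, reading_constEmb] at h'
  exact unitsOfK_injective p K h'

/-- **`hconst` at the hull: `Aut_C(A)` FIXES the constants** — `biratAutModel A σ (constEmb k) = constEmb k` for every `σ` (the natural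
action reads as `a(g)`, which fixes `K`; Def. 3.6 (iii)/(iv): morphisms of the Frobenioid are `K`-linear).
[cite: MochizukiEtTh2009, Def 3.6 (iv) p.304 (PDF p.78); Lem 5.8 p.331 (PDF p.105)] -/
theorem biratAutModel_constEmb (A : (temperedFrobenioid p a ha hΓ R S).category) (σ : Aut A) (k : (K)ˣ) :
    (temperedFrobenioid p a ha hΓ R S).biratAutModel A σ (constEmb p a ha K hK hΓ R S A k) = constEmb p a ha K hK hΓ R S A k := by
  obtain ⟨g, hg⟩ := Quotient.exists_rep (CosetCat.pt ((equiv hΓ).inverse.map (ModelFrobenioid.baseMap σ.inv)))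
  apply reading_injective p a ha hΓ R S A
  rw [reading_biratAutModel p a ha hΓ R S A σ _ hg.symm, reading_constEmb]
  exact smul_eq_of_mem p a K hK (k : K).2 g

/-- **Naturality of the constants** (`hnat`): the pull-back of `constEmb k` along any morphism `φ : A' → A` of the hull is `constEmb k`
(both read as `k`; abc-iut-L2-t9's `pullFracModel = B(Base φ)` on units).  [cite: MochizukiEtTh2009, Lem 5.8 p.331 (PDF p.105)] -/
theorem pullFracModel_constEmb {A A' : (temperedFrobenioid p a ha hΓ R S).category} (φ : A' ⟶ A) (k : (K)ˣ) :
    (temperedFrobenioid p a ha hΓ R S).pullFracModel φ (constEmb p a ha K hK hΓ R S A k) = constEmb p a ha K hK hΓ R S A' k := by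
  obtain ⟨g, hg⟩ := Quotient.exists_rep (CosetCat.pt ((equiv hΓ).inverse.map (ModelFrobenioid.baseMap φ)))
  apply reading_injective p a ha hΓ R S A'
  rw [reading_pullFracModel p a ha hΓ R S φ _ hg.symm, reading_constEmb, reading_constEmb]
  exact smul_eq_of_mem p a K hK (k : K).2 g

end BsFldHull

end Literature.AnabelianGeometry.EtaleTheta

end
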